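import Mathlib
import Summits.NavierStokesRegularity.NavierStokesRegularity.Theorems.DssFarFieldSlavingBlowupTypeIDssProfileSimilarityEnstrophyHardyCore
import Summits.NavierStokesRegularity.NavierStokesRegularity.Theorems.DssFarFieldSlavingBlowupTypeIDssProfileSmoothRepresentativeAe
import HarnessLib

/-!
# E29 / T38: the Hardy-weighted stretching threshold `¼` — classical (physical + similarity) and CLASS level given (D_M)
  (pub-ns-dss theory T38-SCOPE (S4) Row 1; route `DssFarFieldSlaving`, crux `BlowupTypeIDssProfile`,
  stmt-NavierStokesRegularity-0155 — SUPPORT; typer seat g6, 2026-08-23)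

HONEST FRAMING. Conditional exclusion statements about a HYPOTHETICAL object (a Type-I rotated-DSS ancient mild solution /
its smooth Type-I representatives): IF the scale-invariant gauge bounds (D) of orders 1, 2, 3 hold AND the Hardy-weighted
stretching threshold `‖x − x₀‖² ⟪∇V ω, ω⟫ ≤ ¼‖ω‖²` holds everywhere about one centre, THEN the field vanishes. The class
wrapper takes (D_M) — «every KNSS-gauge Type-I field with the Type-I decay admits the gauge bounds of orders 1, 2, 3» — as ONE
NAMED input `hD`; it is a regularity statement from the literature on Type-I ancient mild solutions, NOT a tree theorem, so
the class statement is CONDITIONAL on it. Census words on ACCEPT are the lead's (theory T38-S4: «E29 EMPTY at CLASS level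
given (D_M)»). Nothing numeric is asserted; no profile is claimed to exist or not to exist; nothing here bears on
Navier–Stokes regularity or blow-up. Idea credit for the Hardy-weighted threshold: the OPEN item
`StretchingWellBinding.DssProfileBinding` (stmt-1578), not addressed here; threshold `¼` = the sharp Hardy constant.

CONTENTS. `typeI_ancient_hardyStretching_eq_zero_sim` (similarity variables, centre `e^{s/2} x₀`),
**`typeI_ancient_hardyStretching_eq_zero`** (physical variables; the threshold is invariant under the similarity change of
variables: `Ω = λ²ω`, `DU = λ²∇V`, `y − e^{s/2}x₀ = λ⁻¹(x − x₀)`, `λ = e^{−s/2}`), and the CLASS wrapper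
**`rdssClass_hardyStretching_empty`** in the pattern of `ExplicitThreshold.rdssClass_subcriticalStrain_empty_unconditional`
(any Type-I constant `M`, any factor `c > 1`, ANY twist `R ∈ O(3)`; the threshold quantified over EVERY smooth Type-I
representative; smooth representative from `typeI_ancient_smoothRepresentative_ae`). Statement shapes: theory
`T38-S4-Statements.lean` e5200616154e5d2e with `GaugeBound V k C_k` unfolded to the `DssProfileBinding` token shape
`∀ t < 0, ∀ x, (‖x‖ + √(−t))^(k+1) ‖iteratedFDeriv ℝ k (V t) x‖ ≤ C_k`. [this file; theory T38-SCOPE (S4) Row 1]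
-/

noncomputable section

set_option linter.dupNamespace false

namespace Summit.NavierStokesRegularity.NavierStokesRegularity.Theorems.SimilarityEnstrophy

open MeasureTheory Set Filter Topology InnerProductSpace Function
open scoped RealInnerProductSpace ContDiff
open Literature.Analysis Literature.Analysis.FluidPDE
open Summit.NavierStokesRegularity.NavierStokesRegularity.Theorems

variable {M : ℝ} {V : ℝ → EuclideanSpace ℝ (Fin 3) → EuclideanSpace ℝ (Fin 3)}

/-- **T38 / E29, CLASSICAL level, similarity variables** (theory T38-S4 Row 1, `_sim` twin). Let `V`
be a KNSS-gauge Type-I field with the scale-invariant gauge bounds (D) of orders `1, 2, 3`. If the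
Hardy-weighted stretching threshold `‖y − e^{s/2} x₀‖² ⟪DU(s,y) Ω(s,y), Ω(s,y)⟫ ≤ ¼ ‖Ω(s,y)‖²`
holds for all `s, y` (centre transported along the similarity flow, `y₀(s) = e^{s/2} x₀`; on
`{Ω = 0}` both sides vanish, so no direction field is needed), then `V ≡ 0` on `t < 0`.
[this file: `eq_zero_of_hardySubcriticalStretching` with `y₀(s) = e^{s/2} x₀`; EXPLICIT-THRESHOLDS
T38 (DERIVED); the hypothesis is conditional — nothing asserts that (D) or the threshold holds for
a given field] -/
theorem typeI_ancient_hardyStretching_eq_zero_sim (hV : IsTypeIAncientMild M V)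
    {C₁ C₂ C₃ : ℝ}
    (hD1 : ∀ t < 0, ∀ x, (‖x‖ + Real.sqrt (-t)) ^ (1 + 1) * ‖iteratedFDeriv ℝ 1 (V t) x‖ ≤ C₁)
    (hD2 : ∀ t < 0, ∀ x, (‖x‖ + Real.sqrt (-t)) ^ (2 + 1) * ‖iteratedFDeriv ℝ 2 (V t) x‖ ≤ C₂)
    (hD3 : ∀ t < 0, ∀ x, (‖x‖ + Real.sqrt (-t)) ^ (3 + 1) * ‖iteratedFDeriv ℝ 3 (V t) x‖ ≤ C₃)
    (x₀ : EuclideanSpace ℝ (Fin 3))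
    (hH : ∀ (s : ℝ) (y : EuclideanSpace ℝ (Fin 3)), ‖y - Real.exp (s / 2) • x₀‖ ^ 2 *
        ⟪fderiv ℝ (lerayOrbit V s) y (lerayVorticity V s y), lerayVorticity V s y⟫ ≤
      (1 / 4) * ‖lerayVorticity V s y‖ ^ 2) :
    ∀ t < 0, ∀ x, V t x = 0 :=
  eq_zero_of_hardySubcriticalStretching hV hD1 hD2 hD3 fun s =>
    ⟨Real.exp (s / 2) • x₀, fun y => by
      have h := hH s y
      rw [real_inner_comm] at h
      linarith⟩

/-- **T38 / E29, CLASSICAL level, physical variables** (theory T38-S4 Row 1). Let `V` be a KNSS-gauge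
Type-I field (`IsTypeIAncientMild M V`) with the scale-invariant gauge bounds (D) of orders `1, 2, 3`
(`(‖x‖ + √(−t))^{k+1} ‖D^k V(t,x)‖ ≤ C_k`). If for one centre `x₀` the Hardy-weighted stretching
threshold `‖x − x₀‖² ⟪∇V(t,x) ω(t,x), ω(t,x)⟫ ≤ ¼ ‖ω(t,x)‖²` (`ω = curl V`) holds at every `t < 0`
and every `x`, then `V ≡ 0` on `t < 0`. Proof: the threshold is invariant under the similarity
change of variables (`Ω = λ²ω`, `DU = λ²∇V`, `y − e^{s/2}x₀ = λ⁻¹(x − x₀)`, `λ = e^{−s/2}`: both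
sides scale by `λ⁴`), so `typeI_ancient_hardyStretching_eq_zero_sim` applies. [this file;
EXPLICIT-THRESHOLDS T38 (DERIVED): threshold `¼` = the sharp Hardy constant; conditional statement —
nothing asserts the hypotheses for a given field; nothing here bears on NS regularity] -/
theorem typeI_ancient_hardyStretching_eq_zero (hV : IsTypeIAncientMild M V) {C₁ C₂ C₃ : ℝ}
    (hD1 : ∀ t < 0, ∀ x, (‖x‖ + Real.sqrt (-t)) ^ (1 + 1) * ‖iteratedFDeriv ℝ 1 (V t) x‖ ≤ C₁)
    (hD2 : ∀ t < 0, ∀ x, (‖x‖ + Real.sqrt (-t)) ^ (2 + 1) * ‖iteratedFDeriv ℝ 2 (V t) x‖ ≤ C₂)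
    (hD3 : ∀ t < 0, ∀ x, (‖x‖ + Real.sqrt (-t)) ^ (3 + 1) * ‖iteratedFDeriv ℝ 3 (V t) x‖ ≤ C₃)
    (x₀ : EuclideanSpace ℝ (Fin 3))
    (hH : ∀ t < 0, ∀ x, ‖x - x₀‖ ^ 2 * ⟪fderiv ℝ (V t) x (curl (V t) x), curl (V t) x⟫ ≤
      (1 / 4) * ‖curl (V t) x‖ ^ 2) :
    ∀ t < 0, ∀ x, V t x = 0 := by
  refine typeI_ancient_hardyStretching_eq_zero_sim hV hD1 hD2 hD3 x₀ fun s y => ?_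
  set l : ℝ := Real.exp (-s / 2) with hl
  have hl0 : 0 < l := Real.exp_pos _
  have hls : Real.exp (-s) = l ^ 2 := (exp_neg_half_sq s).symm
  have hel : Real.exp (s / 2) = l⁻¹ := by
    rw [hl, ← Real.exp_neg]; congr 1; ring
  have ht0 : -Real.exp (-s) < 0 := neg_neg_of_pos (Real.exp_pos _)
  have hΩ : lerayVorticity V s y = l ^ 2 • curl (V (-Real.exp (-s))) (l • y) := by
    rw [lerayVorticity_apply, curl_lerayOrbit, hls]
  have hDU : fderiv ℝ (lerayOrbit V s) y = l ^ 2 • fderiv ℝ (V (-Real.exp (-s))) (l • y) := by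
    rw [fderiv_lerayOrbit, hls]
  have hy : y - Real.exp (s / 2) • x₀ = l⁻¹ • (l • y - x₀) := by
    rw [hel, smul_sub, smul_smul, inv_mul_cancel₀ hl0.ne', one_smul]
  have h := hH _ ht0 (l • y)
  rw [hΩ, hDU, hy]
  simp only [_root_.smul_apply, map_smul, real_inner_smul_left, real_inner_smul_right,
    norm_smul, Real.norm_eq_abs, abs_inv, abs_pow, abs_of_pos hl0]
  have e : (l⁻¹ * ‖l • y - x₀‖) ^ 2 * (l ^ 2 * (l ^ 2 * (l ^ 2 *
      ⟪fderiv ℝ (V (-Real.exp (-s))) (l • y) (curl (V (-Real.exp (-s))) (l • y)),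
        curl (V (-Real.exp (-s))) (l • y)⟫))) =
      l ^ 4 * (‖l • y - x₀‖ ^ 2 * ⟪fderiv ℝ (V (-Real.exp (-s))) (l • y)
        (curl (V (-Real.exp (-s))) (l • y)), curl (V (-Real.exp (-s))) (l • y)⟫) := by
    field_simp
  rw [e]
  calc l ^ 4 * (‖l • y - x₀‖ ^ 2 * ⟪fderiv ℝ (V (-Real.exp (-s))) (l • y)
        (curl (V (-Real.exp (-s))) (l • y)), curl (V (-Real.exp (-s))) (l • y)⟫)
      ≤ l ^ 4 * ((1 / 4) * ‖curl (V (-Real.exp (-s))) (l • y)‖ ^ 2) :=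
        mul_le_mul_of_nonneg_left h (pow_nonneg hl0.le 4)
    _ = (1 / 4) * (l ^ 2 * ‖curl (V (-Real.exp (-s))) (l • y)‖) ^ 2 := by ring

/-- **E29 at CLASS level, given (D_M)** (theory T38-S4 Row 1, pattern of
`ExplicitThreshold.rdssClass_subcriticalStrain_empty_unconditional`). ONE NAMED class input `hD` =
(D_M): every KNSS-gauge Type-I field with the Type-I decay admits scale-invariant gauge bounds of
orders `1, 2, 3` (a published regularity statement for Type-I ancient mild solutions, NOT a tree
theorem — this wrapper is CONDITIONAL on it). Given `hD`, NO member of the hypothesis class of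
`RdssProfileTruncation` — any Type-I constant `M`, any factor `c > 1`, ANY twist `R ∈ O(3)` — has all
its smooth Type-I representatives satisfying the Hardy-weighted stretching threshold `¼` about some
centre (representatives quantified as in the E23/E24 wrappers, since the class speaks about an a.e.
object). MECHANISM DSS-BLIND (red R-89, lead A193 (b)): the proof DISCARDS the factor `c`, the twist
`R` and `IsRotatedDSS` (`rintro ⟨c, R, u, -, …, -, …⟩`) — given (D_M), the emptiness holds verbatim for
EVERY Type-I-decay ancient mild solution whose smooth Type-I representatives satisfy the threshold;
no self-similarity, period or rotation is used. [this file; census words on ACCEPT are the lead's;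
conditional on (D_M); nothing numerical is asserted and nothing here bears on NS regularity] -/
theorem rdssClass_hardyStretching_empty
    (hD : ∀ ⦃M : ℝ⦄ ⦃V : ℝ → EuclideanSpace ℝ (Fin 3) → EuclideanSpace ℝ (Fin 3)⦄,
      IsTypeIAncientMild M V → HasTypeIDecay M V →
      ∃ C₁ C₂ C₃ : ℝ,
        (∀ t < 0, ∀ x, (‖x‖ + Real.sqrt (-t)) ^ (1 + 1) * ‖iteratedFDeriv ℝ 1 (V t) x‖ ≤ C₁) ∧
        (∀ t < 0, ∀ x, (‖x‖ + Real.sqrt (-t)) ^ (2 + 1) * ‖iteratedFDeriv ℝ 2 (V t) x‖ ≤ C₂) ∧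
        (∀ t < 0, ∀ x, (‖x‖ + Real.sqrt (-t)) ^ (3 + 1) * ‖iteratedFDeriv ℝ 3 (V t) x‖ ≤ C₃))
    (M : ℝ) :
    ¬ ∃ (c : ℝ) (R : (EuclideanSpace ℝ (Fin 3)) ≃ₗᵢ[ℝ] (EuclideanSpace ℝ (Fin 3)))
        (u : ℝ → (EuclideanSpace ℝ (Fin 3)) → (EuclideanSpace ℝ (Fin 3))),
      1 < c ∧ IsAncientMildSolution 1 u ∧ (∀ t < 0, AEStronglyMeasurable (u t) volume) ∧
      IsRotatedDSS c R u ∧ HasTypeIDecay M u ∧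
      (∀ V : ℝ → EuclideanSpace ℝ (Fin 3) → EuclideanSpace ℝ (Fin 3), IsTypeIAncientMild M V →
        (∀ t < 0, V t =ᵐ[volume] u t) →
        ∃ x₀ : EuclideanSpace ℝ (Fin 3), ∀ t < 0, ∀ x,
          ‖x - x₀‖ ^ 2 * ⟪fderiv ℝ (V t) x (curl (V t) x), curl (V t) x⟫ ≤
            (1 / 4) * ‖curl (V t) x‖ ^ 2) ∧
      ¬ (∀ t < 0, u t =ᵐ[volume] 0) := by
  rintro ⟨c, R, u, -, hmild, hmeas, -, hdec, hthr, hne⟩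
  obtain ⟨V, hT, hTD, hVu, -⟩ := typeI_ancient_smoothRepresentative_ae hmild hmeas hdec
  obtain ⟨C₁, C₂, C₃, hD1, hD2, hD3⟩ := hD hT hTD
  obtain ⟨x₀, hx₀⟩ := hthr V hT hVu
  have hz : ∀ t < 0, ∀ x, V t x = 0 :=
    typeI_ancient_hardyStretching_eq_zero hT hD1 hD2 hD3 x₀ hx₀
  refine hne fun t ht => ?_
  have hVz : V t = 0 := funext fun x => by simpa using hz t ht x
  exact (hVu t ht).symm.trans (Filter.EventuallyEq.of_eq hVz)

end Summit.NavierStokesRegularity.NavierStokesRegularity.Theorems.SimilarityEnstrophy
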